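import Literature.Computability.AlgebraicComplexity.AlmanLi2026IteratedFreeLunch
import Literature.Computability.AlgebraicComplexity.AlmanLi2026CWPowerSpeedup
import HarnessLib

/-!
# Thm. 6.2 applied to Prop. 7.1: the iterated speedup of `cw_q^{⊠n}` (Alman–Li 2026, §7.1)

Topic `Literature/Computability/AlgebraicComplexity` (family `MatrixMultiplication`). Source: J. Alman,
B. Li, *Asymptotic Rank Speedup Theorems, Revisited*, arXiv:2605.21738 (2026), §7.1, the display
after Cor. 7.1 (held text `paper:arxiv-2605.21738`, p0017 L100–107): "We can further apply the
second method to iteratively speed up the degeneration. By (thm:iterate) [Thm. 6.2], we obtain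
`cw_q^{⊗2n} ⊕ 2⊙cw_q^{⊗n} ⊗ ⟨1,(q+2)^n−2(q+1)^n+q^n,1⟩ ⊕ ⟨1,[(q+2)^n−2(q+1)^n+q^n]² + 2(q+1)^{2n},1⟩
⊴ (⟨(q+2)^n⟩ ⊕ ⟨1,q^n,1⟩)^{⊗2}`."

This file proves that display over any field `K`, in the coordinates of
`AlmanLi2026IteratedFreeLunch` (`AlmanLi2026.thm62_cw`): the target is
`(cw_q^{⊠n} ⊕ ⟨1,t,1⟩)^{⊠2}` with the corner `⟨1,t,1⟩^{⊠2}` deleted (`squareMinusCorner`) plus the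
slice `⟨1, t² + 2(q+1)^{2n}, 1⟩`, `t = (q+2)^n + q^n − 2(q+1)^n`, slices with trivial factor third.
Route = the printed one: Thm. 6.2 (`thm62_rankDecomposition`, λ-free case) over `L = K(λ)` for the
rank-`(q+2)^n` decomposition of `T_L^{⊠n}` (`T_L = λ³cw_q + O(λ⁴)`, `prop71_data`, Lemma 7.1's
functional tensored up: `contraction_pow_eq_powMatrix`, `rank_powMatrix_le`), then the bootstrapping
`ε := λ^N` (`algDegeneratesTo_of_isFractionRing`), equalising the `λ`-orders of the blocks
(`6n` for `cw^{⊠n} ⊠ cw^{⊠n}`, `3n` for the mixed blocks, `0` for the slices) by an `L`-restriction.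
No named facts. The reshaping into the tree's fact `AlmanLi2026_iteratedSpeedup_cw` (three matMul
directions, `⟨2⟩ ⊗ (cw^{⊗n} ⊗ ⟨1,t,1⟩)`, `cw^{⊗2n}`) is NOT done here.

## References

* J. Alman, B. Li, *Asymptotic Rank Speedup Theorems, Revisited*, arXiv:2605.21738 (2026), Thm. 6.2,
  Prop. 7.1, §7.1 display (held text p0015 L57–97, p0017 L63–107). [AlmanLi2026]
-/

noncomputable section

open scoped BigOperators Polynomial
open Polynomial

namespace Literature.Computability.AlgebraicComplexity

namespace AlmanLi2026

variable (K : Type) [Field K] (q : ℕ)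

/-- Images of `0/1` tensors under `φ ∘ C`: the Kronecker square of `⟨r⟩ ⊕ ⟨1,s,1⟩` over `L` is the
image of the one over `K`. [folklore] -/
private theorem kronecker_unit_slice_eq_map {L : Type*} [CommRing L] [Algebra K[X] L] (r s : ℕ) :
    kroneckerTensor (directSumTensor (unitTensor L r) (rotate (oneSliceTensor L (Fin s))))
        (directSumTensor (unitTensor L r) (rotate (oneSliceTensor L (Fin s)))) =
      fun a b c => algebraMap K[X] L (Polynomial.C
        (kroneckerTensor (directSumTensor (unitTensor K r) (rotate (oneSliceTensor K (Fin s))))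
          (directSumTensor (unitTensor K r) (rotate (oneSliceTensor K (Fin s)))) a b c)) := by
  funext a b c
  rw [kroneckerTensor_apply, kroneckerTensor_apply, map_mul, map_mul]
  congr 1 <;>
  · rcases a with ⟨a | a, a' | a'⟩ <;> rcases b with ⟨b | b, b' | b'⟩ <;> rcases c with ⟨c | c, c' | c'⟩ <;>
      simp [directSumTensor, unitTensor_apply, rotate_apply, oneSliceTensor_apply,
        apply_ite Polynomial.C, apply_ite (algebraMap K[X] L)]

/-- Coefficients of `ε^h · C v`: the profile "order `h`, leading coefficient `v`". [folklore] -/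
private theorem coeff_X_pow_mul_C_ite (h : ℕ) (v : K) :
    ∀ j ≤ h, (X ^ h * Polynomial.C v : K[X]).coeff j = if j = h then v else 0 := by
  intro j _
  rw [Polynomial.coeff_X_pow_mul', Polynomial.coeff_C]
  by_cases hj : j = h
  · subst hj; simp
  · rw [if_neg hj]
    split_ifs with h1 h2
    · omega
    · rfl
    · rfl

set_option maxHeartbeats 1000000 in -- 64-way block case analysis in `hscale`
/-- **Alman–Li 2026, Thm. 6.2 ∘ Prop. 7.1 (the iterated degeneration of §7.1), over any field.**
For all `q, n` with `2(q+1)^n ≤ (q+2)^n + q^n` (always true; it makes the truncated subtractions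
exact), writing `t = (q+2)^n + q^n − 2(q+1)^n`:
`(⟨(q+2)^n⟩ ⊕ ⟨1,q^n,1⟩)^{⊠2} ⊵ (cw_q^{⊠n} ⊕ ⟨1,t,1⟩)^{⊠2}∖(⟨1,t,1⟩^{⊠2}) ⊕ ⟨1, t² + 2(q+1)^{2n}, 1⟩`
(the corner-deleted square is `cw_q^{⊠2n} ⊕ 2⊙cw_q^{⊠n}⊗⟨1,t,1⟩` up to relabelling).
[cite: AlmanLi2026, §7.1 (display after Cor. 7.1: Thm. 6.2 applied to Prop. 7.1)] -/
theorem thm62_cw (n : ℕ) (h2N : 2 * (q + 1) ^ n ≤ (q + 2) ^ n + q ^ n) :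
    AlgDegeneratesTo
      (kroneckerTensor
        (directSumTensor (unitTensor K ((q + 2) ^ n)) (rotate (oneSliceTensor K (Fin (q ^ n)))))
        (directSumTensor (unitTensor K ((q + 2) ^ n)) (rotate (oneSliceTensor K (Fin (q ^ n))))))
      (directSumTensor
        (squareMinusCorner (kroneckerPow (cwTensor K q) n)
          (rotate (oneSliceTensor K (Fin ((q + 2) ^ n + q ^ n - 2 * (q + 1) ^ n)))))
        (rotate (oneSliceTensor K (Fin
          (((q + 2) ^ n + q ^ n - 2 * (q + 1) ^ n) ^ 2 + 2 * (q + 1) ^ (2 * n)))))) := by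
  classical
  set φ : K[X] →+* RatFunc K := algebraMap K[X] (RatFunc K) with hφdef
  obtain ⟨P₁, u, v, w, c', hP₁, hdec, hc'0, hM1⟩ := prop71_data K q
  obtain ⟨TL, hTLdef⟩ : ∃ TL : Fin (q + 1) → Fin (q + 1) → Fin (q + 1) → RatFunc K,
      TL = fun a b c => φ (P₁ a b c) := ⟨_, rfl⟩
  have hTLdec : ∀ a b c, TL a b c = ∑ i, u i a * v i b * w i c := by
    intro a b c
    rw [hTLdef]
    exact hdec a b c
  -- tensoring: decomposition of `T_L^{⊠n}` and `rank (M^{⊗n}) ≤ q^n`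
  have hTn : ∀ a b c, kroneckerPow TL n a b c = ∑ f : Fin n → Fin (q + 2),
      (∏ l, u (f l) (a l)) * (∏ l, v (f l) (b l)) * ∏ l, w (f l) (c l) :=
    kroneckerPow_eq_sum_decomposition (A := fun a i => u i a) (B := fun b i => v i b)
      (C := fun c i => w i c) hTLdec n
  have hMn : (Matrix.of fun (a b : Fin n → Fin (q + 1)) => ∑ f : Fin n → Fin (q + 2),
      (∏ l, u (f l) (a l)) * (∏ l, v (f l) (b l)) * ∏ l, c' (f l)).rank ≤ q ^ n := by
    rw [contraction_pow_eq_powMatrix (fun a i => u i a) (fun b i => v i b) c' n]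
    exact (rank_powMatrix_le _ n).trans (Nat.pow_le_pow_left hM1 n)
  -- reindex the decomposition by `Fin ((q+2)^n)`
  have e : (Fin n → Fin (q + 2)) ≃ Fin ((q + 2) ^ n) :=
    Fintype.equivFinOfCardEq (by rw [Fintype.card_fun, Fintype.card_fin, Fintype.card_fin])
  have hTn' : ∀ a b c, kroneckerPow TL n a b c = ∑ i : Fin ((q + 2) ^ n),
      (∏ l, u (e.symm i l) (a l)) * (∏ l, v (e.symm i l) (b l)) * ∏ l, w (e.symm i l) (c l) :=
    fun a b c => by rw [hTn, ← e.symm.sum_comp]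
  have hMn' : (Matrix.of fun (a b : Fin n → Fin (q + 1)) => ∑ i : Fin ((q + 2) ^ n),
      (∏ l, u (e.symm i l) (a l)) * (∏ l, v (e.symm i l) (b l)) * ∏ l, c' (e.symm i l)).rank
        ≤ q ^ n := by
    have heq : (Matrix.of fun (a b : Fin n → Fin (q + 1)) => ∑ i : Fin ((q + 2) ^ n),
        (∏ l, u (e.symm i l) (a l)) * (∏ l, v (e.symm i l) (b l)) * ∏ l, c' (e.symm i l)) =
        Matrix.of fun (a b : Fin n → Fin (q + 1)) => ∑ f : Fin n → Fin (q + 2),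
          (∏ l, u (f l) (a l)) * (∏ l, v (f l) (b l)) * ∏ l, c' (f l) := by
      ext a b
      rw [Matrix.of_apply, Matrix.of_apply]
      exact e.symm.sum_comp (fun f => (∏ l, u (f l) (a l)) * (∏ l, v (f l) (b l)) * ∏ l, c' (f l))
    rw [heq]
    exact hMn
  -- the slice size `t`
  have hcard : Fintype.card (Fin n → Fin (q + 1)) = (q + 1) ^ n := by
    rw [Fintype.card_fun, Fintype.card_fin, Fintype.card_fin]
  set t := (q + 2) ^ n + q ^ n - 2 * (q + 1) ^ n with ht
  have htle : t ≤ (q + 2) ^ n + q ^ n -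
      (Fintype.card (Fin n → Fin (q + 1)) + Fintype.card (Fin n → Fin (q + 1))) := by
    rw [hcard]; omega
  -- Thm. 6.2 over `L`
  have hdegL := thm62_rankDecomposition (K := RatFunc K) (T := kroneckerPow TL n)
    (A := fun a i => ∏ l, u (e.symm i l) (a l)) (B := fun b i => ∏ l, v (e.symm i l) (b l))
    (C₀ := fun c i => ∏ l, w (e.symm i l) (c l)) hTn' (c' := fun i => ∏ l, c' (e.symm i l))
    (fun i => prod_coeff_ne_zero hc'0 (e.symm i)) hMn' htle
  -- the appended slice size `t' = t² + 2(q+1)^{2n}`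
  set t' := t ^ 2 + 2 * (q + 1) ^ (2 * n) with ht'
  have ht'le : t' ≤ ((q + 2) ^ n + q ^ n) * ((q + 2) ^ n + q ^ n) -
      ((Fintype.card (Fin n → Fin (q + 1)) * Fintype.card (Fin n → Fin (q + 1)) +
          2 * (Fintype.card (Fin n → Fin (q + 1)) * t)) +
        (Fintype.card (Fin n → Fin (q + 1)) * Fintype.card (Fin n → Fin (q + 1)) +
          2 * (Fintype.card (Fin n → Fin (q + 1)) * t))) := by
    rw [hcard]
    have hsum : (q + 2) ^ n + q ^ n = 2 * (q + 1) ^ n + t := by omega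
    have hsq : (2 * (q + 1) ^ n + t) * (2 * (q + 1) ^ n + t) =
        (t ^ 2 + 2 * (q + 1) ^ (2 * n)) +
          (((q + 1) ^ n * (q + 1) ^ n + 2 * ((q + 1) ^ n * t)) +
            ((q + 1) ^ n * (q + 1) ^ n + 2 * ((q + 1) ^ n * t))) := by
      ring
    rw [hsum, hsq, Nat.add_sub_cancel]
  have hdegL₂ := hdegL.trans_restrictsTo ((TensorRestrictsTo.refl _).directSum
    (tensorRestrictsTo_rotate_oneSliceTensor_of_le (K := RatFunc K) ht'le))
  -- the `K[λ]`-family `Q₁ = P₁^{⊠n} ⊕ λ^{3n}⟨1,t,1⟩ = λ^{3n} (cw^{⊠n} ⊕ ⟨1,t,1⟩) + O(λ^{3n+1})`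
  obtain ⟨Q₁, hQ₁def⟩ : ∃ Q₁ : (Fin n → Fin (q + 1)) ⊕ Fin t → (Fin n → Fin (q + 1)) ⊕ Fin t →
      (Fin n → Fin (q + 1)) ⊕ Unit → K[X],
      Q₁ = directSumTensor (kroneckerPow P₁ n)
        (fun x y z => X ^ (n * 3) * Polynomial.C (rotate (oneSliceTensor K (Fin t)) x y z)) :=
    ⟨_, rfl⟩
  have hQ₁ : ∀ a b c, ∀ j ≤ n * 3, (Q₁ a b c).coeff j = if j = n * 3 then
      directSumTensor (kroneckerPow (cwTensor K q) n) (rotate (oneSliceTensor K (Fin t))) a b c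
      else 0 := by
    intro a b c j hj
    rcases a with a | a <;> rcases b with b | b <;> rcases c with c | c
    · rw [hQ₁def, directSumTensor_inl, directSumTensor_inl]
      exact kroneckerPow_coeff_of_lowest hP₁ n a b c j hj
    · simp [hQ₁def, directSumTensor]
    · simp [hQ₁def, directSumTensor]
    · simp [hQ₁def, directSumTensor]
    · simp [hQ₁def, directSumTensor]
    · simp [hQ₁def, directSumTensor]
    · simp [hQ₁def, directSumTensor]
    · rw [hQ₁def, directSumTensor_inr, directSumTensor_inr]
      exact coeff_X_pow_mul_C_ite K (n * 3) _ j hj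
  -- the full family `P`: corner-deleted square of `Q₁`, plus `λ^{6n} ⟨1,t',1⟩`
  obtain ⟨P, hPdef⟩ : ∃ P :
      (((Fin n → Fin (q + 1)) × (Fin n → Fin (q + 1))) ⊕
        (((Fin n → Fin (q + 1)) × Fin t) ⊕ (Fin t × (Fin n → Fin (q + 1))))) ⊕ Fin t' →
      (((Fin n → Fin (q + 1)) × (Fin n → Fin (q + 1))) ⊕
        (((Fin n → Fin (q + 1)) × Fin t) ⊕ (Fin t × (Fin n → Fin (q + 1))))) ⊕ Fin t' →
      (((Fin n → Fin (q + 1)) × (Fin n → Fin (q + 1))) ⊕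
        (((Fin n → Fin (q + 1)) × Unit) ⊕ (Unit × (Fin n → Fin (q + 1))))) ⊕ Unit → K[X],
      P = directSumTensor
        (fun x y z => Q₁ (cornerCompl _ _ x).1 (cornerCompl _ _ y).1 (cornerCompl _ _ z).1 *
          Q₁ (cornerCompl _ _ x).2 (cornerCompl _ _ y).2 (cornerCompl _ _ z).2)
        (fun x y z => X ^ (n * 3 + n * 3) *
          Polynomial.C (rotate (oneSliceTensor K (Fin t')) x y z)) := ⟨_, rfl⟩
  have hPcoeff : ∀ a b c, ∀ j ≤ n * 3 + n * 3, (P a b c).coeff j = if j = n * 3 + n * 3 then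
      directSumTensor
        (squareMinusCorner (kroneckerPow (cwTensor K q) n) (rotate (oneSliceTensor K (Fin t))))
        (rotate (oneSliceTensor K (Fin t'))) a b c
      else 0 := by
    intro a b c j hj
    rcases a with a | a <;> rcases b with b | b <;> rcases c with c | c
    · rw [hPdef, directSumTensor_inl, directSumTensor_inl]
      exact coeff_mul_eq_ite_of_coeff_eq_ite (hQ₁ _ _ _) (hQ₁ _ _ _) j hj
    · simp [hPdef, directSumTensor]
    · simp [hPdef, directSumTensor]
    · simp [hPdef, directSumTensor]
    · simp [hPdef, directSumTensor]
    · simp [hPdef, directSumTensor]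
    · simp [hPdef, directSumTensor]
    · rw [hPdef, directSumTensor_inr, directSumTensor_inr]
      exact coeff_X_pow_mul_C_ite K (n * 3 + n * 3) _ j hj
  -- equalise the `λ`-orders over `L`: scale the third mode blockwise (`1`, `λ^{3n}`, `λ^{3n}`; `λ^{6n}`)
  have hscale : TensorRestrictsTo
      (directSumTensor
        (squareMinusCorner (kroneckerPow TL n) (rotate (oneSliceTensor (RatFunc K) (Fin t))))
        (rotate (oneSliceTensor (RatFunc K) (Fin t'))))
      (fun a b c => φ (P a b c)) := by
    refine ⟨fun a a' => if a' = a then 1 else 0, fun b b' => if b' = b then 1 else 0,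
      fun c c' => if c' = c then
        Sum.elim (Sum.elim (fun _ => (1 : RatFunc K))
          (Sum.elim (fun _ => φ X ^ (n * 3)) (fun _ => φ X ^ (n * 3))))
          (fun _ => φ X ^ (n * 3 + n * 3)) c else 0,
      fun a b c => ?_⟩
    rw [Finset.sum_eq_single a (fun x _ hx => by simp [hx]) (by simp),
      Finset.sum_eq_single b (fun x _ hx => by simp [hx]) (by simp),
      Finset.sum_eq_single c (fun x _ hx => by simp [hx]) (by simp)]
    simp only [if_true, one_mul]
    rcases a with (a | a | a) | a <;> rcases b with (b | b | b) | b <;>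
      rcases c with (c | c | c) | c <;>
      (simp [hPdef, hQ₁def, squareMinusCorner, cornerCompl, directSumTensor, kroneckerTensor_apply,
        hTLdef, kroneckerPow_apply, map_prod, rotate_apply, oneSliceTensor_apply,
        apply_ite Polynomial.C, apply_ite φ]; try simp only [mul_comm])
  have hdegL' : AlgDegeneratesTo
      (fun a b c => φ (Polynomial.C
        (kroneckerTensor
          (directSumTensor (unitTensor K ((q + 2) ^ n)) (rotate (oneSliceTensor K (Fin (q ^ n)))))
          (directSumTensor (unitTensor K ((q + 2) ^ n)) (rotate (oneSliceTensor K (Fin (q ^ n)))))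
          a b c)))
      (fun a b c => φ (P a b c)) := by
    rw [← kronecker_unit_slice_eq_map K]
    exact hdegL₂.trans_restrictsTo hscale
  -- bootstrap `K(λ) → K`
  exact algDegeneratesTo_of_isFractionRing (K := K) (L := RatFunc K) hPcoeff hdegL'

end AlmanLi2026

end Literature.Computability.AlgebraicComplexity
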